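import Summits.QuantumAdvantage.QuantumAdvantage.Theorems.MobiusLadderLiouvilleOrthogonalTC0Defs
import HarnessLib

/-!
# Crux `MobiusLadder.LiouvilleOrthogonalTC0` (stmt-QuantumAdvantage-1393), line `Sketch`:
# monotonicity of the hypothesis `LocalPieceHardness` in its parameters

The line's open stub (skeleton v3) is
`stub_hyp_pos : ∃ δ₀ κ Λ₀, 0 < δ₀ ∧ 0 < κ ∧ 1 ≤ Λ₀ ∧ ∀ A ≥ 1, LocalPieceHardness δ₀ κ Λ₀ A`.
This file records that the hypothesis is monotone in each real parameter — weaker for smaller `δ₀`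
(`localPieceHardness_mono_delta`), for larger `κ` (`localPieceHardness_mono_kappa`: fewer boxes
qualify) and for larger `Λ₀` (`localPieceHardness_mono_lambda`: fewer windows qualify) — so the
proposer of the stub may always shrink `δ₀` and enlarge `κ, Λ₀`; packaged as the equivalence
`exists_localPieceHardness_iff_eventually`: the stub holds iff some `δ₀ > 0` works for ALL
sufficiently large `κ` and `Λ₀`.  (Relevant because constant predictors force `Λ₀ > 3` for `κ ≤ 1`,
`δ₀ < log(1+κ)/(1+log(1+κ))`, and a `TC⁰` primality test on rough numbers would force `κ ≥ 2`; see the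
line card `Cruxes/LiouvilleOrthogonalTC0/Lines/Sketch.md`.)
-/

set_option linter.dupNamespace false -- D-0017: single-problem summit ⇒ `QuantumAdvantage.QuantumAdvantage` by design

noncomputable section

namespace Summit.QuantumAdvantage.QuantumAdvantage.Theorems.LiouvilleOrthogonalTC0

open Filter Finset
open Literature.Computability.Complexity

/-- **Monotonicity in `δ₀`**: a smaller error constant is a weaker demand. -/
theorem localPieceHardness_mono_delta {δ₀ δ₁ κ Λ₀ : ℝ} {A : ℕ} (hδ : δ₁ ≤ δ₀)
    (h : LocalPieceHardness δ₀ κ Λ₀ A) : LocalPieceHardness δ₁ κ Λ₀ A := by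
  intro d p
  filter_upwards [h d p] with n hn
  intro y z b θ hy hz hb hθ hθ1 hbox hU g hg
  exact le_trans (mul_le_mul_of_nonneg_right hδ (Nat.cast_nonneg _))
    (hn y z b θ hy hz hb hθ hθ1 hbox hU g hg)

/-- **Monotonicity in `κ`**: a larger `κ` (boxes further above `y²`) is a weaker demand. -/
theorem localPieceHardness_mono_kappa {δ₀ κ κ₁ Λ₀ : ℝ} {A : ℕ} (hκ : κ ≤ κ₁)
    (h : LocalPieceHardness δ₀ κ Λ₀ A) : LocalPieceHardness δ₀ κ₁ Λ₀ A := by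
  intro d p
  filter_upwards [h d p] with n hn
  intro y z b θ hy hz hb hθ hθ1 hbox hU g hg
  have hy1 : (1 : ℝ) ≤ y := le_trans (Real.one_le_rpow (by norm_num) (by positivity)) hy
  have hb' : (y : ℝ) ^ (2 + κ) ≤ b :=
    le_trans (Real.rpow_le_rpow_of_exponent_le hy1 (by linarith)) hb
  exact hn y z b θ hy hz hb' hθ hθ1 hbox hU g hg

/-- **Monotonicity in `Λ₀`**: a larger `Λ₀` (wider compulsory prime window) is a weaker demand. -/
theorem localPieceHardness_mono_lambda {δ₀ κ Λ₀ Λ₁ : ℝ} {A : ℕ} (hΛ : Λ₀ ≤ Λ₁)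
    (h : LocalPieceHardness δ₀ κ Λ₀ A) : LocalPieceHardness δ₀ κ Λ₁ A := by
  intro d p
  filter_upwards [h d p] with n hn
  intro y z b θ hy hz hb hθ hθ1 hbox hU g hg
  have hy1 : (1 : ℝ) ≤ y := le_trans (Real.one_le_rpow (by norm_num) (by positivity)) hy
  have hz' : (y : ℝ) ^ Λ₀ ≤ z := le_trans (Real.rpow_le_rpow_of_exponent_le hy1 hΛ) hz
  exact hn y z b θ hy hz' hb hθ hθ1 hbox hU g hg

/-- **The open stub, restated with the parameters sent to their easy ends**: some
`(δ₀, κ, Λ₀)` gives hardness at every `A ≥ 1` iff some `δ₀ > 0` gives hardness at every `A ≥ 1`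
for ALL sufficiently large `κ` and `Λ₀`. -/
theorem exists_localPieceHardness_iff_eventually :
    (∃ δ₀ κ Λ₀ : ℝ, 0 < δ₀ ∧ 0 < κ ∧ 1 ≤ Λ₀ ∧ ∀ A : ℕ, 1 ≤ A → LocalPieceHardness δ₀ κ Λ₀ A) ↔
    (∃ δ₀ K : ℝ, 0 < δ₀ ∧ ∀ κ Λ₀ : ℝ, K ≤ κ → K ≤ Λ₀ →
      ∀ A : ℕ, 1 ≤ A → LocalPieceHardness δ₀ κ Λ₀ A) := by
  constructor
  · rintro ⟨δ₀, κ, Λ₀, hδ₀, -, -, h⟩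
    refine ⟨δ₀, max κ Λ₀, hδ₀, fun κ' Λ₀' hκ' hΛ₀' A hA => ?_⟩
    exact localPieceHardness_mono_lambda ((le_max_right κ Λ₀).trans hΛ₀')
      (localPieceHardness_mono_kappa ((le_max_left κ Λ₀).trans hκ') (h A hA))
  · rintro ⟨δ₀, K, hδ₀, h⟩
    refine ⟨δ₀, max K 1, max K 1, hδ₀, lt_of_lt_of_le one_pos (le_max_right K 1),
      le_max_right K 1, fun A hA => h _ _ (le_max_left K 1) (le_max_left K 1) A hA⟩

end Summit.QuantumAdvantage.QuantumAdvantage.Theorems.LiouvilleOrthogonalTC0
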